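import Summits.Ventures.DiscreteObjects.PP12.FlagOrbitFinite

/-!
# The generic flag-cell orbit-matrix statement forces the block structure of the side and T-line rows (kernel; consequences for the engines)
Framing: lottery ticket; floor = certified bounds/negative ranges.

Cell pub-namedobj (venture DiscreteObjects), target (M), designs gen 15. The structured statements for `f = 10, 7` (`FlagTenOrbitData`,
`FlagSevenOrbitData`) carry FUNCTIONS `κ` (the `l`-orbit a side passes through), `γ`/`β` (the orbit on `m_j` met by a side / a T-line); the plain
statement `IsFlagOrbitMatrix ρ M` (p344983) has no such data, but it IMPLIES the corresponding block structure, which an engine may therefore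
hard-wire (one-hot blocks) without loss:
* `col_entry_le_one_of_not_tri` — the `Z`-columns and the T-point columns are `0/1` columns (column norm = column total);
* `side_Z_block` — every side row has exactly ONE entry `1` among the `Z`-columns (`κ`): the `Z`-columns are pairwise orthogonal, vanish on
  the c-line and T-line rows, and have total `12` each, while there are `12ρ` side rows;
* `tpt_block` — every side row and every T-line row has exactly ONE entry `1` in each block `{(j,t) : t}` of T-point columns (`γ`, `β`):
  the four columns of a block are pairwise orthogonal, vanish on the c-line rows, have total `12` each, and there are `48` non-c-line rows.
(The block sums `3` over the triangle columns of each class are `IsFlagOrbitMatrix.tri_block_sum` in `FlagOrbitMatrix`.) Pure consequences of the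
seven conjuncts; nothing decides any `NoFlagOrbitMatrix ρ`. No `sorry`, no new axioms.
-/

namespace Summit.Ventures.DiscreteObjects.PP12

open Finset

namespace IsFlagOrbitMatrix

variable {ρ : ℕ} {M : FRow ρ → FCol ρ → ℕ}

/-- **`Z`-columns and T-point columns are `0/1` columns** (column norm = column total = `12`). -/
theorem col_entry_le_one_of_not_tri (h : IsFlagOrbitMatrix ρ M) (c₀ : FCol ρ) (hc : ∀ x : Fin ρ × Fin 12, c₀ ≠ Sum.inr (Sum.inl x))
    (r₀ : FRow ρ) : M r₀ c₀ ≤ 1 := by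
  by_contra hlt
  push Not at hlt
  have hsq : ∑ r : FRow ρ, M r c₀ * M r c₀ = ∑ r : FRow ρ, M r c₀ := by
    rw [h.2.2.2.1 c₀ c₀, h.2.1 c₀]
    rcases c₀ with t | x | ⟨j, t⟩
    · simp [FlagOrbit.colTarget, FlagOrbit.colSum]
    · exact absurd rfl (hc x)
    · simp [FlagOrbit.colTarget, FlagOrbit.colSum]
  have h1 : ∑ r : FRow ρ, M r c₀ * M r c₀ = M r₀ c₀ * M r₀ c₀ + ∑ r ∈ univ.erase r₀, M r c₀ * M r c₀ :=
    (Finset.add_sum_erase univ (fun r => M r c₀ * M r c₀) (mem_univ r₀)).symm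
  have h2 : ∑ r : FRow ρ, M r c₀ = M r₀ c₀ + ∑ r ∈ univ.erase r₀, M r c₀ :=
    (Finset.add_sum_erase univ (fun r => M r c₀) (mem_univ r₀)).symm
  have h3 : ∑ r ∈ univ.erase r₀, M r c₀ ≤ ∑ r ∈ univ.erase r₀, M r c₀ * M r c₀ :=
    Finset.sum_le_sum fun r _ => Nat.le_mul_self (M r c₀)
  have h4 : 2 * M r₀ c₀ ≤ M r₀ c₀ * M r₀ c₀ := Nat.mul_le_mul_right _ hlt
  rw [h1, h2] at hsq
  omega

/-- Two orthogonal columns have no common support: if `colTarget c₁ c₂ = 0` then `M r c₁ * M r c₂ = 0` for every row. -/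
theorem entry_mul_eq_zero_of_cols (h : IsFlagOrbitMatrix ρ M) {c₁ c₂ : FCol ρ} (h0 : FlagOrbit.colTarget c₁ c₂ = 0) (r : FRow ρ) :
    M r c₁ * M r c₂ = 0 := by
  have hs := h.2.2.2.1 c₁ c₂
  rw [h0] at hs
  exact (Finset.sum_eq_zero_iff.1 hs) r (mem_univ r)

/-- A `0/1` row segment with pairwise orthogonal columns has block sum `≤ 1`. -/
theorem block_sum_le_one {ι : Type*} [Fintype ι] [DecidableEq ι] (g : ι → ℕ) (hle : ∀ i, g i ≤ 1)
    (horth : ∀ i i', i ≠ i' → g i * g i' = 0) : ∑ i, g i ≤ 1 := by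
  by_contra hlt
  push Not at hlt
  -- two distinct indices with value 1
  have hcard : ∑ i, g i = (univ.filter fun i => g i = 1).card := by
    rw [Finset.card_eq_sum_ones, Finset.sum_filter]
    refine Finset.sum_congr rfl fun i _ => ?_
    have := hle i
    by_cases hi : g i = 1
    · rw [if_pos hi, hi]
    · rw [if_neg hi]; omega
  rw [hcard] at hlt
  obtain ⟨i, hi, i', hi', hne⟩ := Finset.one_lt_card.1 hlt
  rw [mem_filter] at hi hi'
  have := horth i i' hne
  rw [hi.2, hi'.2] at this
  exact absurd this (by norm_num)

/-- If `g ≤ 1` pointwise and `Σ g = |ι|`, then `g ≡ 1`. -/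
theorem eq_one_of_sum_eq_card {ι : Type*} [Fintype ι] (g : ι → ℕ) (hle : ∀ i, g i ≤ 1) (hsum : ∑ i, g i = Fintype.card ι)
    (i₀ : ι) : g i₀ = 1 := by
  by_contra hne
  have hlt0 : g i₀ < 1 := lt_of_le_of_ne (hle i₀) hne
  have hlt : ∑ i, g i < ∑ _i : ι, 1 := Finset.sum_lt_sum (fun i _ => hle i) ⟨i₀, mem_univ _, hlt0⟩
  rw [Finset.sum_const, smul_eq_mul, mul_one, Finset.card_univ] at hlt
  omega

/-- **Every side row passes through exactly one `Z`-orbit:** `Σ_t M (side x) (Z_t) = 1` (the function `κ` of the structured statements). -/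
theorem side_Z_block (h : IsFlagOrbitMatrix ρ M) (x : Fin ρ × Fin 12) : ∑ t : Fin ρ, M (Sum.inr (Sum.inl x)) (Sum.inl t) = 1 := by
  -- block sums ≤ 1 for every side row
  have hle1 : ∀ x' : Fin ρ × Fin 12, ∑ t : Fin ρ, M (Sum.inr (Sum.inl x')) (Sum.inl t) ≤ 1 := by
    intro x'
    refine block_sum_le_one _ (fun t => col_entry_le_one_of_not_tri h (Sum.inl t) (fun _ hh => by cases hh) _) fun t t' htt => ?_
    exact entry_mul_eq_zero_of_cols h (by simp [FlagOrbit.colTarget, htt]) _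
  -- total over all side rows: Σ_t (column total of Z_t restricted to side rows) = 12ρ
  have hcol : ∀ t : Fin ρ, ∑ x' : Fin ρ × Fin 12, M (Sum.inr (Sum.inl x')) (Sum.inl t) = 12 := by
    intro t
    have hs := h.2.1 (Sum.inl t)
    rw [Fintype.sum_sum_type, Fintype.sum_sum_type] at hs
    have hΓ : ∑ s : Fin ρ, M (Sum.inl s) (Sum.inl t) = 0 :=
      Finset.sum_eq_zero fun s _ => by rw [h.2.2.2.2.1 s (Sum.inl t)]; rfl
    have hT : ∑ kt : Fin (12 - 3 * ρ) × Fin 4, M (Sum.inr (Sum.inr kt)) (Sum.inl t) = 0 :=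
      Finset.sum_eq_zero fun kt _ => h.2.2.2.2.2.1 kt t
    rw [hΓ, hT, zero_add, add_zero] at hs
    simpa [FlagOrbit.colSum] using hs
  have htot : ∑ x' : Fin ρ × Fin 12, ∑ t : Fin ρ, M (Sum.inr (Sum.inl x')) (Sum.inl t) = Fintype.card (Fin ρ × Fin 12) := by
    rw [Finset.sum_comm, Finset.sum_congr rfl (fun t _ => hcol t), Finset.sum_const, smul_eq_mul, Finset.card_univ]
    simp
  exact eq_one_of_sum_eq_card _ hle1 htot x

/-- **Every side row and every T-line row meets each fixed line `m_j` in exactly one T-point orbit:** `Σ_t M r (j,t) = 1` for every row `r`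
that is not a c-line row (the functions `γ` and `β` of the structured statements). -/
theorem tpt_block (h : IsFlagOrbitMatrix ρ M) (r : FRow ρ) (hr : ∀ s : Fin ρ, r ≠ Sum.inl s) (j : Fin (12 - 3 * ρ)) :
    ∑ t : Fin 4, M r (Sum.inr (Sum.inr (j, t))) = 1 := by
  have h3ρ : 3 * ρ < 12 := by have := j.2; omega
  -- the non-c-line rows as one type
  let NR : Type := (Fin ρ × Fin 12) ⊕ (Fin (12 - 3 * ρ) × Fin 4)
  let emb : NR → FRow ρ := fun y => Sum.inr y
  have hle1 : ∀ y : NR, ∑ t : Fin 4, M (emb y) (Sum.inr (Sum.inr (j, t))) ≤ 1 := by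
    intro y
    refine block_sum_le_one _ (fun t => col_entry_le_one_of_not_tri h _ (fun _ hh => by cases hh) _) fun t t' htt => ?_
    exact entry_mul_eq_zero_of_cols h (by simp [FlagOrbit.colTarget, htt]) _
  have hcol : ∀ t : Fin 4, ∑ y : NR, M (emb y) (Sum.inr (Sum.inr (j, t))) = 12 := by
    intro t
    have hs := h.2.1 (Sum.inr (Sum.inr (j, t)))
    rw [Fintype.sum_sum_type] at hs
    have hΓ : ∑ s : Fin ρ, M (Sum.inl s) (Sum.inr (Sum.inr (j, t))) = 0 :=
      Finset.sum_eq_zero fun s _ => by rw [h.2.2.2.2.1 s]; rfl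
    rw [hΓ, zero_add] at hs
    show ∑ y : NR, M (Sum.inr y) (Sum.inr (Sum.inr (j, t))) = 12
    rw [Fintype.sum_sum_type]
    simpa [FlagOrbit.colSum] using hs
  have hcard : Fintype.card NR = 48 := by
    simp only [NR, Fintype.card_sum, Fintype.card_prod, Fintype.card_fin]
    omega
  have htot : ∑ y : NR, ∑ t : Fin 4, M (emb y) (Sum.inr (Sum.inr (j, t))) = Fintype.card NR := by
    rw [Finset.sum_comm, Finset.sum_congr rfl (fun t _ => hcol t), Finset.sum_const, smul_eq_mul, Finset.card_univ, hcard]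
    simp
  rcases r with s | y
  · exact absurd rfl (hr s)
  · exact eq_one_of_sum_eq_card _ hle1 htot y

end IsFlagOrbitMatrix

end Summit.Ventures.DiscreteObjects.PP12
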